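import Mathlib.GroupTheory.Nilpotent
import Literature.RepresentationTheory.FiniteGroups.BurnsidePaQbTheorem
import Literature.RepresentationTheory.FiniteGroups.BrauerFowler
import HarnessLib

/-!
# A group with an abelian subgroup of prime-power index is not perfect
# (Isaacs, *Character Theory of Finite Groups*, Problem 3.5)

Topic `Literature/RepresentationTheory/FiniteGroups`, namespace
`Literature.RepresentationTheory.FiniteGroups` (lane `lit-hodgefound`, prover p38, row g17-#9; uses
`BurnsidePaQbTheorem` (Thm. 3.9: a group with a conjugacy class of prime-power size `> 1` is not
simple), `BrauerFowler` (`|x^G| = |G : C_G(x)|`) and Mathlib's nilpotent / solvable groups).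
Everything here is **proved**; no definition, no named fact.

Source, verbatim.  I. M. Isaacs, *Character Theory of Finite Groups*, Academic Press 1976 (held
`book:isaacsnd-character-theory-finite-groups`, p. 48 = p0048 L24; Problems to Chapter 3):

> "(3.5) Suppose `A ⊆ G` is abelian and `|G : A|` is a prime power. Show that `G' < G`."

(For `G = 1` the conclusion is void; we assume `G ≠ 1`.)

The solution formalised (induction on `|G|`, Thm. 3.9).  If `A ⊆ Z(G)` then `|G : Z(G)|` divides
`|G : A|`, so `G/Z(G)` is a `p`-group, `G` is nilpotent and `G' < G`
(**`commutator_ne_top_of_le_center_of_index_eq_prime_pow`**).  Otherwise pick `a ∈ A − Z(G)`;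
then `A ⊆ C_G(a)`, so `|a^G| = |G : C_G(a)|` divides `|G : A|` and is a prime power `> 1`, and `G`
is not simple by Thm. 3.9 (**`not_isSimpleGroup_of_index_eq_prime_pow`**).  Take `1 < N ◁ G`
proper; `AN/N ⊆ G/N` is abelian of prime-power index, so `(G/N)' < G/N` by induction, and
`G' < G` (**`commutator_ne_top_of_index_eq_prime_pow`**, **`commutator_lt_top_of_index_eq_prime_pow`**
= Problem 3.5).

## Mathlib / tree search

Mathlib: `IsPGroup.of_card`, `IsPGroup.isNilpotent`, `Group.of_quotient_center_nilpotent`,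
`IsSolvable.commutator_lt_of_ne_bot`, `Subgroup.index_dvd_of_le`, `Subgroup.index_map_dvd`,
`Subgroup.map_commutator`, `Nat.dvd_prime_pow`, `IsSimpleGroup`; no such statement
(`lean search 'abelian.*prime power index|index_eq_prime_pow.*commutator'`: nothing).  Tree,
consumed by name: `not_isSimpleGroup_of_card_carrier_eq_prime_pow` (`BurnsidePaQbTheorem`,
Thm. 3.9), `natCard_carrier_eq_index_centralizer` (`BrauerFowler`).

## References

* I. M. Isaacs, *Character Theory of Finite Groups*, Academic Press 1976, Problem 3.5 (with
  Thm. 3.9) (`Isaacs1976`).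
-/

namespace Literature.RepresentationTheory.FiniteGroups

/-! ## §1 The central case -/

/-- **`A ⊆ Z(G)` of prime-power index (`G ≠ 1`) ⇒ `G' < G`**: `G/Z(G)` is a `p`-group, so `G` is
nilpotent, hence solvable. [cite: Isaacs1976, Problem 3.5] -/
theorem commutator_ne_top_of_le_center_of_index_eq_prime_pow {G : Type} [Group G] [Finite G]
    [Nontrivial G] {A : Subgroup G} (hA : A ≤ Subgroup.center G) {p n : ℕ} (hp : p.Prime)
    (hidx : A.index = p ^ n) : ⁅(⊤ : Subgroup G), (⊤ : Subgroup G)⁆ ≠ ⊤ := by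
  haveI : Fact p.Prime := ⟨hp⟩
  have hdvd : (Subgroup.center G).index ∣ p ^ n := hidx ▸ Subgroup.index_dvd_of_le hA
  obtain ⟨k, -, hk⟩ := (Nat.dvd_prime_pow hp).mp hdvd
  have hcardQ : Nat.card (G ⧸ Subgroup.center G) = p ^ k := by
    rw [← Subgroup.index_eq_card, hk]
  have hPQ : IsPGroup p (G ⧸ Subgroup.center G) := IsPGroup.of_card hcardQ
  haveI : Group.IsNilpotent (G ⧸ Subgroup.center G) := hPQ.isNilpotent
  haveI : Group.IsNilpotent G := Group.of_quotient_center_nilpotent inferInstance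
  have htop : (⊤ : Subgroup G) ≠ ⊥ := by
    intro h
    obtain ⟨x, hx⟩ := exists_ne (1 : G)
    exact hx ((Subgroup.mem_bot).mp (h ▸ Subgroup.mem_top x))
  exact (IsSolvable.commutator_lt_of_ne_bot htop).ne

/-! ## §2 The non-central case: `G` is not simple (Thm. 3.9) -/

/-- **If `A ⊆ G` is abelian of prime-power index and `A ⊄ Z(G)`, then `G` is not simple**: for
`a ∈ A − Z(G)`, `|a^G| = |G : C_G(a)|` divides `|G : A|` and exceeds `1` (Thm. 3.9).
[cite: Isaacs1976, Problem 3.5] -/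
theorem not_isSimpleGroup_of_index_eq_prime_pow {G : Type} [Group G] [Fintype G]
    {A : Subgroup G} (hA : ∀ a ∈ A, ∀ b ∈ A, a * b = b * a) (hAZ : ¬ A ≤ Subgroup.center G)
    {p n : ℕ} (hp : p.Prime) (hidx : A.index = p ^ n) : ¬ IsSimpleGroup G := by
  classical
  obtain ⟨a, haA, haZ⟩ := SetLike.not_le_iff_exists.mp hAZ
  have hAle : A ≤ Subgroup.centralizer ({a} : Set G) := by
    intro b hb
    rw [Subgroup.mem_centralizer_iff]
    intro y hy
    rw [Set.mem_singleton_iff] at hy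
    subst hy
    exact hA y haA b hb
  have hdvd : (Subgroup.centralizer ({a} : Set G)).index ∣ p ^ n :=
    hidx ▸ Subgroup.index_dvd_of_le hAle
  obtain ⟨r, -, hr⟩ := (Nat.dvd_prime_pow hp).mp hdvd
  have hr0 : r ≠ 0 := by
    rintro rfl
    rw [pow_zero, Subgroup.index_eq_one] at hr
    apply haZ
    rw [Subgroup.mem_center_iff]
    intro g
    have hg : g ∈ Subgroup.centralizer ({a} : Set G) := hr ▸ Subgroup.mem_top g
    exact (Subgroup.mem_centralizer_iff.mp hg a (Set.mem_singleton a)).symm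
  have hcl : Nat.card (ConjClasses.mk a).carrier = p ^ r := by
    rw [natCard_carrier_eq_index_centralizer, hr]
  exact not_isSimpleGroup_of_card_carrier_eq_prime_pow hp hr0 hcl

/-! ## §3 Problem 3.5 -/

/-- The induction on `|G|`. [cite: Isaacs1976, Problem 3.5] -/
private theorem commutator_ne_top_aux (m : ℕ) : ∀ (G : Type) [Group G] [Fintype G],
    Fintype.card G = m → Nontrivial G → ∀ A : Subgroup G, (∀ a ∈ A, ∀ b ∈ A, a * b = b * a) →
    ∀ p n : ℕ, p.Prime → A.index = p ^ n → ⁅(⊤ : Subgroup G), (⊤ : Subgroup G)⁆ ≠ ⊤ := by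
  induction m using Nat.strong_induction_on with
  | _ m ih =>
  intro G _ _ hcard hnt A hA p n hp hidx
  classical
  haveI := hnt
  by_cases hAZ : A ≤ Subgroup.center G
  · exact commutator_ne_top_of_le_center_of_index_eq_prime_pow hAZ hp hidx
  · have hns := not_isSimpleGroup_of_index_eq_prime_pow hA hAZ hp hidx
    -- a proper non-trivial normal subgroup
    obtain ⟨N, hN, hNbot, hNtop⟩ : ∃ N : Subgroup G, N.Normal ∧ N ≠ ⊥ ∧ N ≠ ⊤ := by
      by_contra hall
      push Not at hall
      exact hns
        { toNontrivial := hnt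
          eq_bot_or_eq_top_of_normal := fun N hN => by
            by_cases h : N = ⊥
            · exact Or.inl h
            · exact Or.inr (hall N hN h) }
    haveI := hN
    -- the quotient is smaller, non-trivial, and `AN/N` is abelian of prime-power index
    have hidxN : N.index = Fintype.card (G ⧸ N) := by
      rw [Subgroup.index_eq_card, Nat.card_eq_fintype_card]
    have hlt : Fintype.card (G ⧸ N) < m := by
      rw [← hcard, ← hidxN, ← Nat.card_eq_fintype_card, ← N.card_mul_index]
      have h1 : 1 < Nat.card N := (Subgroup.one_lt_card_iff_ne_bot N).mpr hNbot
      have h2 : 0 < N.index := Nat.pos_of_ne_zero Subgroup.index_ne_zero_of_finite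
      nlinarith
    have hntQ : Nontrivial (G ⧸ N) := by
      rw [← Fintype.one_lt_card_iff_nontrivial, ← hidxN]
      have h1 : N.index ≠ 1 := fun h => hNtop (Subgroup.index_eq_one.mp h)
      have h2 : N.index ≠ 0 := Subgroup.index_ne_zero_of_finite
      omega
    set f : G →* G ⧸ N := QuotientGroup.mk' N with hf
    have hfs : Function.Surjective f := QuotientGroup.mk'_surjective N
    have hA' : ∀ x ∈ A.map f, ∀ y ∈ A.map f, x * y = y * x := by
      rintro x ⟨a, ha, rfl⟩ y ⟨b, hb, rfl⟩
      rw [← map_mul, ← map_mul, hA a ha b hb]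
    have hdvd : (A.map f).index ∣ p ^ n := hidx ▸ Subgroup.index_map_dvd A hfs
    obtain ⟨r, -, hr⟩ := (Nat.dvd_prime_pow hp).mp hdvd
    have hQ := ih (Fintype.card (G ⧸ N)) hlt (G ⧸ N) rfl hntQ (A.map f) hA' p r hp hr
    -- `G' = G` would give `(G/N)' = G/N`
    intro htop
    apply hQ
    have hmap := Subgroup.map_commutator (⊤ : Subgroup G) (⊤ : Subgroup G) f
    rw [htop, Subgroup.map_top_of_surjective f hfs] at hmap
    exact hmap.symm

/-- **Isaacs, Problem 3.5: "Suppose `A ⊆ G` is abelian and `|G : A|` is a prime power. Show that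
`G' < G`."** (`G ≠ 1`; `G' = [G, G]`.) [cite: Isaacs1976, Problem 3.5] -/
theorem commutator_ne_top_of_index_eq_prime_pow {G : Type} [Group G] [Fintype G] [Nontrivial G]
    (A : Subgroup G) (hA : ∀ a ∈ A, ∀ b ∈ A, a * b = b * a) {p n : ℕ} (hp : p.Prime)
    (hidx : A.index = p ^ n) : ⁅(⊤ : Subgroup G), (⊤ : Subgroup G)⁆ ≠ ⊤ :=
  commutator_ne_top_aux (Fintype.card G) G rfl inferInstance A hA p n hp hidx

/-- **Isaacs, Problem 3.5**, in the form `G' < G` with Mathlib's `commutator G`.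
[cite: Isaacs1976, Problem 3.5] -/
theorem commutator_lt_top_of_index_eq_prime_pow {G : Type} [Group G] [Fintype G] [Nontrivial G]
    (A : Subgroup G) (hA : ∀ a ∈ A, ∀ b ∈ A, a * b = b * a) {p n : ℕ} (hp : p.Prime)
    (hidx : A.index = p ^ n) : commutator G < ⊤ := by
  rw [lt_top_iff_ne_top, commutator_def]
  exact commutator_ne_top_of_index_eq_prime_pow A hA hp hidx

end Literature.RepresentationTheory.FiniteGroups
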